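import Summits.QuantumFields.YangMills.Theorems.FemtoCutoffLadderFixedLatticeLawInnerRateBOPrelim
import Summits.QuantumFields.YangMills.Theorems.LuscherReductionRunningReductionCoarseUpperScales
import HarnessLib

/-!
# The Born–Oppenheimer ∕ Feshbach–Schur DOOR WITH RATE for `stub_innerRate` (crux `FixedLatticeLaw` stmt-QuantumFields-23943 ≡ leaf `FemtoGapFixedLattice`,
# route `FemtoCutoffLadder`, line «rate»): an ADIABATIC SPLIT of every inner family + the k = 0 FLOOR WITH RATE ⟹ the one-orbit INNER NO-INTRUDER WITH RATE

Lead seat `ym-line-fcl-p1` g4 (2026-08-28).  The registered stub `stub_innerRate` (RED's C4 text at level one with tolerance `e^{C·λ_b(L³β)²}`) is reduced in the tree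
to its ONE-ORBIT gauge-invariant form (`innerRate_of_oneOrbitRate`, `…InnerRateCopies`).  The design note `Cruxes/FixedLatticeLaw/Lines/rate.md` (appendix, §1(c))
says WHERE the rate comes from: a proof organised as «Born–Oppenheimer projection + stiff gap» pays the slow–fast cross term only to SECOND order once it is played
against the stiff gap (completed square ∕ Feshbach–Schur), and the toron zero-point energy has the helpful SIGN on the inner region.  This file is that
organising principle, kernel-checked and abstract in the adiabatic data — so that the remaining analysis is a list of INDEPENDENT estimates on named pieces:
* (preliminaries in `…FixedLatticeLawInnerRateBOPrelim`: bounded-measurable bookkeeping `qform_split_bdd` / `l2_split_bdd` for the split `ψ = φ + χ` — the inner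
  families of the one-orbit text are gauge-invariant but NOT physical —, the EXACT max–min half of Courant–Fischer in family form `exists_comb_qform_le_levelValue'`,
  and the completed-square bookkeeping `feshbach_endgame` / `bo_numeric_endgame`);
* §4 ★★ `oneOrbitRate_of_bo` (level `k`, scale `δ`): if, eventually in `β`, there is a normalisation `N(β) > 0` with the FLOOR WITH RATE
  `N·μ₀(L³β)·e^{−C·u²} ≤ λ₀(β,L)` (`u = λ_b(L³β)`), and every bounded measurable gauge-invariant `(k+1)`-family `G` supported in `{orbitDist < δ(β)}` admits an
  ADIABATIC SPLIT — bounded measurable `φᵢ` (think `f_i ⊗ Ω_c`, the projection onto the dressed stiff ground state) and a PHYSICAL ONE-SITE family `gᵢ` (think the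
  dressed slow profile `e^{−V/2}·f_i`, `V ≥ −C u²` the relative stiff zero-point energy) such that for every combination, with `χ = ψ − φ`:
  (P1) almost-orthogonality `2|⟨φ,χ⟩| ≤ C u² (‖φ‖² + ‖χ‖²)`; (P3) STIFF GAP on the excited sector `⟨χ,Kχ⟩ ≤ (1 − gap)·N μ_k·‖χ‖²`;
  (P4) CROSS TERM to second order `⟨φ,Kχ⟩² ≤ C u²·(N μ_k)²·‖φ‖²‖χ‖²`; (P5) DIAGONAL vs the one-site form at `B = L³β`: `⟨φ,Kφ⟩ ≤ e^{Cu²}·N·⟨g,K₁^{(B)}g⟩ + C u²·N μ_k·‖φ‖²`;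
  (P6) dressing costs `‖g‖² ≤ e^{Cu²}‖φ‖²` — then the hypothesis `hI1` of `innerRate_of_oneOrbitRate` holds with `C₁ = 6|C| + |C|/gap`
  (one-site max–min §2 on the dressed family, completed square §3, floor);
* §5 ★★ `innerRateAt_of_bo` — composed with the landed eight-copies step: the PHYSICAL-family INNER NO-INTRUDER WITH RATE at level `k`, scale `δ` (positive,
  eventually `≤ 1/(2L)`); at `k = 1`, `δ = powScale (1/40)` its conclusion is literally the `L`-clause of the registered stub's statement `InnerRateAll`.
HONEST FRAMING: a DOOR (bookkeeping + the variational principle); the adiabatic split (P1)–(P6) and the floor with rate are the OPEN fixed-lattice semiclassics of C4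
(construction of the dressed stiff ground state `Ω_c` near the trivial orbit of `SU(2)^{E}`, its gap, the second-order slow–fast estimate) and are NOT proved here;
femto rung R2b1 (RECORD label) — not infinite volume, not a mass gap, not Clay.  No definitions, no named facts, no `sorry`.
-/

set_option autoImplicit false

noncomputable section

open MeasureTheory Filter Topology Real
open scoped BigOperators
open Literature.MathematicalPhysics.QuantumFieldTheory hiding SU2
open Literature.MathematicalPhysics.QuantumLattice

namespace Summit.QuantumFields.YangMills.Theorems.FemtoCutoffLadder

open Summit.QuantumFields.YangMills.Theorems.FemtoTransferGap

variable {L : ℕ} [NeZero L]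

/-! ## §4 ★★ The door: adiabatic split + floor with rate ⟹ one-orbit INNER NO-INTRUDER WITH RATE -/

/-- ★★ **THE BORN–OPPENHEIMER DOOR WITH RATE** (level `k`, inner scale `δ`).  Suppose that eventually in `β` (with `u = λ_b(L³β)`, `μ_j = levelValue su2Rep 1 (L³β) j`)
there is a normalisation `N > 0` with the FLOOR WITH RATE `N·μ₀·e^{−C u²} ≤ λ₀(β,L)`, and every bounded measurable gauge-invariant `(k+1)`-family `G` supported in
`{orbitDist < δ(β)}` has an ADIABATIC SPLIT: bounded measurable `φᵢ` on the lattice and a PHYSICAL ONE-SITE family `gᵢ` such that every combination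
`ψ = Σ aᵢGᵢ`, `φ = Σ aᵢφᵢ`, `χ = ψ − φ`, `g = Σ aᵢgᵢ` obeys (P1) `2|⟨φ,χ⟩| ≤ C u²(‖φ‖² + ‖χ‖²)`, (P3) `⟨χ,K_βχ⟩ ≤ (1 − gap)·N μ_k·‖χ‖²` (`gap > 0` fixed),
(P4) `⟨φ,K_βχ⟩² ≤ C u²·(N μ_k)²·‖φ‖²‖χ‖²`, (P5) `⟨φ,K_βφ⟩ ≤ e^{C u²}·N·⟨g,K^{(1)}_{L³β} g⟩ + C u²·N μ_k·‖φ‖²`, (P6) `‖g‖² ≤ e^{C u²}‖φ‖²`.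
Then the one-orbit INNER NO-INTRUDER WITH RATE holds at level `k`, scale `δ`, with `C₁ = 6|C| + |C|/gap` — exactly the hypothesis `hI1` of `innerRate_of_oneOrbitRate`
(one-site max–min `exists_comb_qform_le_levelValue'` on the dressed family, completed square `bo_numeric_endgame`). [cite: GustafsonSigal2003, §11–§12] [cite: Luscher1983, §3] -/
theorem oneOrbitRate_of_bo (k : ℕ) {δ : ℝ → ℝ}
    (hBO : ∃ C gap βB : ℝ, 0 < gap ∧ ∀ β : ℝ, βB ≤ β →
      ∃ N : ℝ, 0 < N ∧
        N * levelValue su2Rep 1 ((L : ℝ) ^ 3 * β) 0 * Real.exp (-(C * bareLambda ((L : ℝ) ^ 3 * β) ^ 2)) ≤ levelValue su2Rep L β 0 ∧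
        ∀ G : Fin (k + 1) → (GaugeConfig 3 L SU2 → ℝ),
          (∀ i, Measurable (G i)) → (∀ i, ∃ C' : ℝ, ∀ U, |G i U| ≤ C') →
          (∀ i (g : Site 3 L → SU2) (U : GaugeConfig 3 L SU2), G i (gaugeTransform g U) = G i U) →
          (∀ i U, G i U ≠ 0 → orbitDist U < δ β) →
          ∃ (φ : Fin (k + 1) → (GaugeConfig 3 L SU2 → ℝ)) (g : Fin (k + 1) → (GaugeConfig 3 1 SU2 → ℝ)),
            (∀ i, Measurable (φ i)) ∧ (∀ i, ∃ C' : ℝ, ∀ U, |φ i U| ≤ C') ∧ (∀ i, IsPhys (g i)) ∧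
            ∀ a : Fin (k + 1) → ℝ,
              2 * |l2 (fun U => ∑ i, a i * φ i U) (fun U => ∑ i, a i * G i U - ∑ i, a i * φ i U)| ≤
                  C * bareLambda ((L : ℝ) ^ 3 * β) ^ 2 *
                    (l2 (fun U => ∑ i, a i * φ i U) (fun U => ∑ i, a i * φ i U) +
                      l2 (fun U => ∑ i, a i * G i U - ∑ i, a i * φ i U) (fun U => ∑ i, a i * G i U - ∑ i, a i * φ i U)) ∧
              qform su2Rep β (fun U => ∑ i, a i * G i U - ∑ i, a i * φ i U) (fun U => ∑ i, a i * G i U - ∑ i, a i * φ i U) ≤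
                  (1 - gap) * (N * levelValue su2Rep 1 ((L : ℝ) ^ 3 * β) k) *
                    l2 (fun U => ∑ i, a i * G i U - ∑ i, a i * φ i U) (fun U => ∑ i, a i * G i U - ∑ i, a i * φ i U) ∧
              qform su2Rep β (fun U => ∑ i, a i * φ i U) (fun U => ∑ i, a i * G i U - ∑ i, a i * φ i U) ^ 2 ≤
                  C * bareLambda ((L : ℝ) ^ 3 * β) ^ 2 * (N * levelValue su2Rep 1 ((L : ℝ) ^ 3 * β) k) ^ 2 *
                    (l2 (fun U => ∑ i, a i * φ i U) (fun U => ∑ i, a i * φ i U) *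
                      l2 (fun U => ∑ i, a i * G i U - ∑ i, a i * φ i U) (fun U => ∑ i, a i * G i U - ∑ i, a i * φ i U)) ∧
              qform su2Rep β (fun U => ∑ i, a i * φ i U) (fun U => ∑ i, a i * φ i U) ≤
                  Real.exp (C * bareLambda ((L : ℝ) ^ 3 * β) ^ 2) * N *
                      qform su2Rep ((L : ℝ) ^ 3 * β) (fun U => ∑ i, a i * g i U) (fun U => ∑ i, a i * g i U) +
                    C * bareLambda ((L : ℝ) ^ 3 * β) ^ 2 * (N * levelValue su2Rep 1 ((L : ℝ) ^ 3 * β) k) *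
                      l2 (fun U => ∑ i, a i * φ i U) (fun U => ∑ i, a i * φ i U) ∧
              l2 (fun U => ∑ i, a i * g i U) (fun U => ∑ i, a i * g i U) ≤
                  Real.exp (C * bareLambda ((L : ℝ) ^ 3 * β) ^ 2) * l2 (fun U => ∑ i, a i * φ i U) (fun U => ∑ i, a i * φ i U)) :
    ∃ C₁ βI : ℝ, ∀ β : ℝ, βI ≤ β →
      ∀ G : Fin (k + 1) → (GaugeConfig 3 L SU2 → ℝ),
        (∀ i, Measurable (G i)) → (∀ i, ∃ C : ℝ, ∀ U, |G i U| ≤ C) →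
        (∀ i (g : Site 3 L → SU2) (U : GaugeConfig 3 L SU2), G i (gaugeTransform g U) = G i U) →
        (∀ i U, G i U ≠ 0 → orbitDist U < δ β) →
        (∀ a : Fin (k + 1) → ℝ, a ≠ 0 → 0 < l2 (fun U => ∑ i, a i * G i U) (fun U => ∑ i, a i * G i U)) →
          ∃ a : Fin (k + 1) → ℝ, a ≠ 0 ∧
            qform su2Rep β (fun U => ∑ i, a i * G i U) (fun U => ∑ i, a i * G i U) * levelValue su2Rep 1 ((L : ℝ) ^ 3 * β) 0 ≤
              Real.exp (C₁ * bareLambda ((L : ℝ) ^ 3 * β) ^ 2) * levelValue su2Rep 1 ((L : ℝ) ^ 3 * β) k *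
                levelValue su2Rep L β 0 * l2 (fun U => ∑ i, a i * G i U) (fun U => ∑ i, a i * G i U) := by
  have hL : (0 : ℝ) < L := by exact_mod_cast Nat.pos_of_ne_zero (NeZero.ne L)
  obtain ⟨C, gap, βB, hgap, hB⟩ := hBO
  have hC'0 : 0 ≤ |C| := abs_nonneg C
  have hCC' : C ≤ |C| := le_abs_self C
  have hτ0 : (0 : ℝ) < 1 / (2 * |C| + 2) := by positivity
  refine ⟨6 * |C| + |C| / gap, max βB (max 1 (2 / (1 / (2 * |C| + 2)) ^ 3)), fun β hβ G hGm hGb hGg hGs _hGram => ?_⟩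
  have hβB : βB ≤ β := (le_max_left _ _).trans hβ
  have hβ1 : 1 ≤ β := ((le_max_left _ _).trans (le_max_right _ _)).trans hβ
  have hβτ : 2 / (1 / (2 * |C| + 2)) ^ 3 ≤ β := ((le_max_right _ _).trans (le_max_right _ _)).trans hβ
  have hB0 : 0 < (L : ℝ) ^ 3 * β := by positivity
  -- `u = λ_b(L³β)` is small: `|C| u² ≤ 1/2`
  have hu0 : 0 < bareLambda ((L : ℝ) ^ 3 * β) := bareLambda_pos' hB0
  have huτ : bareLambda ((L : ℝ) ^ 3 * β) ≤ 1 / (2 * |C| + 2) := bareLambda_cube_le hτ0 hβτ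
  have hux : |C| * bareLambda ((L : ℝ) ^ 3 * β) ^ 2 ≤ 1 / 2 := by
    have hu1 : bareLambda ((L : ℝ) ^ 3 * β) ≤ 1 := huτ.trans (by rw [div_le_one (by positivity)]; linarith)
    have hu2 : bareLambda ((L : ℝ) ^ 3 * β) ^ 2 ≤ bareLambda ((L : ℝ) ^ 3 * β) := by nlinarith
    have h3 : |C| * bareLambda ((L : ℝ) ^ 3 * β) ≤ |C| * (1 / (2 * |C| + 2)) := mul_le_mul_of_nonneg_left huτ hC'0
    have h4 : |C| * (1 / (2 * |C| + 2)) ≤ 1 / 2 := by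
      rw [mul_one_div, div_le_iff₀ (by positivity)]; linarith
    nlinarith
  have hCu : C * bareLambda ((L : ℝ) ^ 3 * β) ^ 2 ≤ |C| * bareLambda ((L : ℝ) ^ 3 * β) ^ 2 :=
    mul_le_mul_of_nonneg_right hCC' (sq_nonneg _)
  have hEu : Real.exp (C * bareLambda ((L : ℝ) ^ 3 * β) ^ 2) ≤ Real.exp (|C| * bareLambda ((L : ℝ) ^ 3 * β) ^ 2) :=
    Real.exp_le_exp.2 hCu
  -- the data at `β`
  obtain ⟨N, hN, hfloor, hfam⟩ := hB β hβB
  obtain ⟨φ, g, hφm, hφb, hgP, hP⟩ := hfam G hGm hGb hGg hGs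
  have hμ0 : 0 < levelValue su2Rep 1 ((L : ℝ) ^ 3 * β) 0 := levelValue_su2Rep_pos (L := 1) hB0 0
  have hμk : 0 < levelValue su2Rep 1 ((L : ℝ) ^ 3 * β) k := levelValue_su2Rep_pos (L := 1) hB0 k
  -- one-site max–min on the dressed family
  obtain ⟨a, ha, hmm⟩ := exists_comb_qform_le_levelValue' (L := 1) hB0 (k := k) g hgP
  refine ⟨a, ha, ?_⟩
  obtain ⟨hP1, hP3, hP4, hP5, hP6⟩ := hP a
  -- bounded-measurable bookkeeping for the split
  obtain ⟨hψm, Cψ, hψb⟩ := TwistedTraceScaling.Negative.R6.comb_measurable_bounded hGm hGb a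
  obtain ⟨hφam, Cφ, hφab⟩ := TwistedTraceScaling.Negative.R6.comb_measurable_bounded hφm hφb a
  have hχm : Measurable (fun U => ∑ i, a i * G i U - ∑ i, a i * φ i U) := hψm.sub hφam
  have hχb : ∀ U, |∑ i, a i * G i U - ∑ i, a i * φ i U| ≤ Cψ + Cφ := fun U =>
    (abs_sub _ _).trans (add_le_add (hψb U) (hφab U))
  have hsplit : ∀ U, (∑ i, a i * G i U) = (∑ i, a i * φ i U) + (∑ i, a i * G i U - ∑ i, a i * φ i U) := fun U => by ring
  have hsn := l2_split_bdd (ψ := fun U => ∑ i, a i * G i U) (φ := fun U => ∑ i, a i * φ i U)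
    (χ := fun U => ∑ i, a i * G i U - ∑ i, a i * φ i U) hsplit hφam hφab hχm hχb
  have hsQ := qform_split_bdd β (ψ := fun U => ∑ i, a i * G i U) (φ := fun U => ∑ i, a i * φ i U)
    (χ := fun U => ∑ i, a i * G i U - ∑ i, a i * φ i U) hsplit hφam hφab hχm hχb
  -- positivity bookkeeping
  have hgphys : IsPhys (fun U => ∑ i, a i * g i U) := isPhys_sum_mul_lat Finset.univ g hgP a
  have hnφ := l2_self_nonneg (fun U => ∑ i, a i * φ i U)
  have hnχ := l2_self_nonneg (fun U => ∑ i, a i * G i U - ∑ i, a i * φ i U)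
  have hnψ := l2_self_nonneg (fun U => ∑ i, a i * G i U)
  have hqg : 0 ≤ qform su2Rep ((L : ℝ) ^ 3 * β) (fun U => ∑ i, a i * g i U) (fun U => ∑ i, a i * g i U) :=
    qform_su2Rep_self_nonneg hB0.le hgphys
  have hMnn : 0 ≤ N * levelValue su2Rep 1 ((L : ℝ) ^ 3 * β) k := by positivity
  -- weaken every `C` to `|C|`
  have hfloor' : N * levelValue su2Rep 1 ((L : ℝ) ^ 3 * β) 0 * Real.exp (-(|C| * bareLambda ((L : ℝ) ^ 3 * β) ^ 2)) ≤
      levelValue su2Rep L β 0 :=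
    le_trans (mul_le_mul_of_nonneg_left (Real.exp_le_exp.2 (neg_le_neg hCu)) (by positivity)) hfloor
  have hP1' := hP1.trans (mul_le_mul_of_nonneg_right hCu (add_nonneg hnφ hnχ))
  have hP4' := hP4.trans (mul_le_mul_of_nonneg_right (mul_le_mul_of_nonneg_right hCu (sq_nonneg _)) (mul_nonneg hnφ hnχ))
  have hP5' := hP5.trans (add_le_add (mul_le_mul_of_nonneg_right (mul_le_mul_of_nonneg_right hEu hN.le) hqg)
    (mul_le_mul_of_nonneg_right (mul_le_mul_of_nonneg_right hCu hMnn) hnφ))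
  have hP6' := hP6.trans (mul_le_mul_of_nonneg_right hEu hnφ)
  exact bo_numeric_endgame (u := bareLambda ((L : ℝ) ^ 3 * β)) (C := |C|) (gap := gap) hN hμ0 hμk hgap hC'0 hux hnφ hnχ hnψ
    hsn hsQ hP1' hP3 hP4' hP5' hP6' hmm hfloor'

/-! ## §5 ★★ Composition with the eight-copies step: the PHYSICAL-family INNER NO-INTRUDER WITH RATE -/

/-- ★★ **INNER NO-INTRUDER WITH RATE from the Born–Oppenheimer data** (level `k`, positive scale `δ` eventually `≤ 1/(2L)`): the door `oneOrbitRate_of_bo` followed by the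
landed eight-copies step `innerRate_of_oneOrbitRate`.  Conclusion = RED's `InnerNoIntruderAt L δ` at level `k` with tolerance `e^{C·λ_b(L³β)²}`.
[cite: Luscher1983, §3] [cite: GustafsonSigal2003, §11–§12] -/
theorem innerRateAt_of_bo (k : ℕ) {δ : ℝ → ℝ} (hδ : ∀ β, 0 < δ β) (hδL : ∃ β1 : ℝ, ∀ β : ℝ, β1 ≤ β → δ β ≤ 1 / (2 * L))
    (hBO : ∃ C gap βB : ℝ, 0 < gap ∧ ∀ β : ℝ, βB ≤ β →
      ∃ N : ℝ, 0 < N ∧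
        N * levelValue su2Rep 1 ((L : ℝ) ^ 3 * β) 0 * Real.exp (-(C * bareLambda ((L : ℝ) ^ 3 * β) ^ 2)) ≤ levelValue su2Rep L β 0 ∧
        ∀ G : Fin (k + 1) → (GaugeConfig 3 L SU2 → ℝ),
          (∀ i, Measurable (G i)) → (∀ i, ∃ C' : ℝ, ∀ U, |G i U| ≤ C') →
          (∀ i (g : Site 3 L → SU2) (U : GaugeConfig 3 L SU2), G i (gaugeTransform g U) = G i U) →
          (∀ i U, G i U ≠ 0 → orbitDist U < δ β) →
          ∃ (φ : Fin (k + 1) → (GaugeConfig 3 L SU2 → ℝ)) (g : Fin (k + 1) → (GaugeConfig 3 1 SU2 → ℝ)),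
            (∀ i, Measurable (φ i)) ∧ (∀ i, ∃ C' : ℝ, ∀ U, |φ i U| ≤ C') ∧ (∀ i, IsPhys (g i)) ∧
            ∀ a : Fin (k + 1) → ℝ,
              2 * |l2 (fun U => ∑ i, a i * φ i U) (fun U => ∑ i, a i * G i U - ∑ i, a i * φ i U)| ≤
                  C * bareLambda ((L : ℝ) ^ 3 * β) ^ 2 *
                    (l2 (fun U => ∑ i, a i * φ i U) (fun U => ∑ i, a i * φ i U) +
                      l2 (fun U => ∑ i, a i * G i U - ∑ i, a i * φ i U) (fun U => ∑ i, a i * G i U - ∑ i, a i * φ i U)) ∧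
              qform su2Rep β (fun U => ∑ i, a i * G i U - ∑ i, a i * φ i U) (fun U => ∑ i, a i * G i U - ∑ i, a i * φ i U) ≤
                  (1 - gap) * (N * levelValue su2Rep 1 ((L : ℝ) ^ 3 * β) k) *
                    l2 (fun U => ∑ i, a i * G i U - ∑ i, a i * φ i U) (fun U => ∑ i, a i * G i U - ∑ i, a i * φ i U) ∧
              qform su2Rep β (fun U => ∑ i, a i * φ i U) (fun U => ∑ i, a i * G i U - ∑ i, a i * φ i U) ^ 2 ≤
                  C * bareLambda ((L : ℝ) ^ 3 * β) ^ 2 * (N * levelValue su2Rep 1 ((L : ℝ) ^ 3 * β) k) ^ 2 *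
                    (l2 (fun U => ∑ i, a i * φ i U) (fun U => ∑ i, a i * φ i U) *
                      l2 (fun U => ∑ i, a i * G i U - ∑ i, a i * φ i U) (fun U => ∑ i, a i * G i U - ∑ i, a i * φ i U)) ∧
              qform su2Rep β (fun U => ∑ i, a i * φ i U) (fun U => ∑ i, a i * φ i U) ≤
                  Real.exp (C * bareLambda ((L : ℝ) ^ 3 * β) ^ 2) * N *
                      qform su2Rep ((L : ℝ) ^ 3 * β) (fun U => ∑ i, a i * g i U) (fun U => ∑ i, a i * g i U) +
                    C * bareLambda ((L : ℝ) ^ 3 * β) ^ 2 * (N * levelValue su2Rep 1 ((L : ℝ) ^ 3 * β) k) *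
                      l2 (fun U => ∑ i, a i * φ i U) (fun U => ∑ i, a i * φ i U) ∧
              l2 (fun U => ∑ i, a i * g i U) (fun U => ∑ i, a i * g i U) ≤
                  Real.exp (C * bareLambda ((L : ℝ) ^ 3 * β) ^ 2) * l2 (fun U => ∑ i, a i * φ i U) (fun U => ∑ i, a i * φ i U)) :
    ∃ C βI : ℝ, ∀ β : ℝ, βI ≤ β →
      ∀ F : Fin (k + 1) → (GaugeConfig 3 L SU2 → ℝ), (∀ i, IsPhys (F i)) →
        (∀ i U, F i U ≠ 0 → ∃ z : Fin 3 → Bool, orbitDist (TT.twist3 z U) < δ β) →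
        (∀ a : Fin (k + 1) → ℝ, a ≠ 0 → 0 < l2 (fun U => ∑ i, a i * F i U) (fun U => ∑ i, a i * F i U)) →
          ∃ a : Fin (k + 1) → ℝ, a ≠ 0 ∧
            qform su2Rep β (fun U => ∑ i, a i * F i U) (fun U => ∑ i, a i * F i U) * levelValue su2Rep 1 ((L : ℝ) ^ 3 * β) 0 ≤
              Real.exp (C * bareLambda ((L : ℝ) ^ 3 * β) ^ 2) * levelValue su2Rep 1 ((L : ℝ) ^ 3 * β) k *
                levelValue su2Rep L β 0 * l2 (fun U => ∑ i, a i * F i U) (fun U => ∑ i, a i * F i U) :=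
  innerRate_of_oneOrbitRate k hδ hδL (oneOrbitRate_of_bo k hBO)

/-- ★★ **The same at a polynomial scale `δ = β^{−p}`, `p > 0`** (eventually `β^{−p} ≤ 1/(2L)`).  At `k = 1`, `p = 1/40` the conclusion is LITERALLY the `L`-clause of the
registered stub statement `InnerRateAll` of crux 23943 (skeleton «rate»): the Born–Oppenheimer data (P1)–(P6) + the floor with rate on every `L` close `stub_innerRate`.
[cite: Luscher1983, §3] [cite: GustafsonSigal2003, §11–§12] -/
theorem innerRateAt_of_bo_pow (k : ℕ) {p : ℝ} (hp : 0 < p)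
    (hBO : ∃ C gap βB : ℝ, 0 < gap ∧ ∀ β : ℝ, βB ≤ β →
      ∃ N : ℝ, 0 < N ∧
        N * levelValue su2Rep 1 ((L : ℝ) ^ 3 * β) 0 * Real.exp (-(C * bareLambda ((L : ℝ) ^ 3 * β) ^ 2)) ≤ levelValue su2Rep L β 0 ∧
        ∀ G : Fin (k + 1) → (GaugeConfig 3 L SU2 → ℝ),
          (∀ i, Measurable (G i)) → (∀ i, ∃ C' : ℝ, ∀ U, |G i U| ≤ C') →
          (∀ i (g : Site 3 L → SU2) (U : GaugeConfig 3 L SU2), G i (gaugeTransform g U) = G i U) →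
          (∀ i U, G i U ≠ 0 → orbitDist U < powScale p β) →
          ∃ (φ : Fin (k + 1) → (GaugeConfig 3 L SU2 → ℝ)) (g : Fin (k + 1) → (GaugeConfig 3 1 SU2 → ℝ)),
            (∀ i, Measurable (φ i)) ∧ (∀ i, ∃ C' : ℝ, ∀ U, |φ i U| ≤ C') ∧ (∀ i, IsPhys (g i)) ∧
            ∀ a : Fin (k + 1) → ℝ,
              2 * |l2 (fun U => ∑ i, a i * φ i U) (fun U => ∑ i, a i * G i U - ∑ i, a i * φ i U)| ≤
                  C * bareLambda ((L : ℝ) ^ 3 * β) ^ 2 *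
                    (l2 (fun U => ∑ i, a i * φ i U) (fun U => ∑ i, a i * φ i U) +
                      l2 (fun U => ∑ i, a i * G i U - ∑ i, a i * φ i U) (fun U => ∑ i, a i * G i U - ∑ i, a i * φ i U)) ∧
              qform su2Rep β (fun U => ∑ i, a i * G i U - ∑ i, a i * φ i U) (fun U => ∑ i, a i * G i U - ∑ i, a i * φ i U) ≤
                  (1 - gap) * (N * levelValue su2Rep 1 ((L : ℝ) ^ 3 * β) k) *
                    l2 (fun U => ∑ i, a i * G i U - ∑ i, a i * φ i U) (fun U => ∑ i, a i * G i U - ∑ i, a i * φ i U) ∧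
              qform su2Rep β (fun U => ∑ i, a i * φ i U) (fun U => ∑ i, a i * G i U - ∑ i, a i * φ i U) ^ 2 ≤
                  C * bareLambda ((L : ℝ) ^ 3 * β) ^ 2 * (N * levelValue su2Rep 1 ((L : ℝ) ^ 3 * β) k) ^ 2 *
                    (l2 (fun U => ∑ i, a i * φ i U) (fun U => ∑ i, a i * φ i U) *
                      l2 (fun U => ∑ i, a i * G i U - ∑ i, a i * φ i U) (fun U => ∑ i, a i * G i U - ∑ i, a i * φ i U)) ∧
              qform su2Rep β (fun U => ∑ i, a i * φ i U) (fun U => ∑ i, a i * φ i U) ≤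
                  Real.exp (C * bareLambda ((L : ℝ) ^ 3 * β) ^ 2) * N *
                      qform su2Rep ((L : ℝ) ^ 3 * β) (fun U => ∑ i, a i * g i U) (fun U => ∑ i, a i * g i U) +
                    C * bareLambda ((L : ℝ) ^ 3 * β) ^ 2 * (N * levelValue su2Rep 1 ((L : ℝ) ^ 3 * β) k) *
                      l2 (fun U => ∑ i, a i * φ i U) (fun U => ∑ i, a i * φ i U) ∧
              l2 (fun U => ∑ i, a i * g i U) (fun U => ∑ i, a i * g i U) ≤
                  Real.exp (C * bareLambda ((L : ℝ) ^ 3 * β) ^ 2) * l2 (fun U => ∑ i, a i * φ i U) (fun U => ∑ i, a i * φ i U)) :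
    ∃ C βI : ℝ, ∀ β : ℝ, βI ≤ β →
      ∀ F : Fin (k + 1) → (GaugeConfig 3 L SU2 → ℝ), (∀ i, IsPhys (F i)) →
        (∀ i U, F i U ≠ 0 → ∃ z : Fin 3 → Bool, orbitDist (TT.twist3 z U) < powScale p β) →
        (∀ a : Fin (k + 1) → ℝ, a ≠ 0 → 0 < l2 (fun U => ∑ i, a i * F i U) (fun U => ∑ i, a i * F i U)) →
          ∃ a : Fin (k + 1) → ℝ, a ≠ 0 ∧
            qform su2Rep β (fun U => ∑ i, a i * F i U) (fun U => ∑ i, a i * F i U) * levelValue su2Rep 1 ((L : ℝ) ^ 3 * β) 0 ≤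
              Real.exp (C * bareLambda ((L : ℝ) ^ 3 * β) ^ 2) * levelValue su2Rep 1 ((L : ℝ) ^ 3 * β) k *
                levelValue su2Rep L β 0 * l2 (fun U => ∑ i, a i * F i U) (fun U => ∑ i, a i * F i U) := by
  have hL : (0 : ℝ) < L := by exact_mod_cast Nat.pos_of_ne_zero (NeZero.ne L)
  refine innerRateAt_of_bo k (fun β => powScale_pos p β) ?_ hBO
  obtain ⟨β0, hβ0⟩ := rpow_neg_eventually_le hp (M := 1 / (2 * L)) (by positivity)
  refine ⟨β0, fun β hβ => ?_⟩
  obtain ⟨hβ1, hle⟩ := hβ0 β hβ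
  rwa [powScale_eq hβ1]

end Summit.QuantumFields.YangMills.Theorems.FemtoCutoffLadder

end
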